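import Summits.Ventures.PercRepro.RLSRuleThreeLinePoint
import Summits.Ventures.PercRepro.RLSZeroWorldT1

/-!
# C-025 at q = 3: `R₃⁺` on the plane `ℓ₃ ∪ {a}` at EVERY type (night-3, gen 3)

`RLSRuleThreeLinePoint` settles the `4`-point plane with a `3`-point line at `t = 0` (`ρ(E ∖ G) ≥ p`).  Here the other
types, on a core matroid of rank `p = n + 4 ≥ 8`:

* `t = 1` (`ρ(E ∖ G) = p − 1`): the demand is at most `3` (`card_UqG_three_line_point_le_t1`: the triples other than `ℓ`,
  since `|B′| + 1 ≤ |G|`), and there is NO `(L3)` loss — `ℓ ⊆ cl(E ∖ G)` would make `a` a coloop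
  (`not_line_subset_closure_compl`), so no coplanar triple exists and every witness is good.  The supply from an independent
  `K ⊆ E ∖ G` of size `n + 3` is `3·t1z0Sum n` (the three triples) `+ 3·t1z1Sum n` (the plane itself), and
  `t1z0Sum n + t1z1Sum n = Φ(n + 4, 3) + 3/4` exactly (`t1_lp4free`), so `3Φ ≤` supply with margin `9/4`
  (`perFlat_three_line_point_t1`).  NOTE: with a coplanar triple present the crude share `3/C(4+x,3)` would NOT suffice
  for `p ≥ 10` — it is the absence of loss at `t = 1` that closes this case.
* `t ≥ 2` (`ρ(E ∖ G) ≤ p − 2`): the demand is `0` (`demandCount 4 t = 0`), nothing to prove.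

**`perFlat_three_line_point_all`**: on `Core M (n + 4)`, `n ≥ 4`, every plane `ℓ ∪ {a}` satisfies the per-flat inequality.
-/

open scoped Matroid

namespace PercRepro

namespace NightThree

open Finset ThmH PerFlat

variable {α : Type*} [DecidableEq α] {M : Matroid α} [M.Finite]

/-- The triple share with `|K| = n + 3` sums to `t1z0Sum n`. -/
theorem sum_witness_eq_t1z0 {K : Finset α} {n : ℕ} (hK : K.card = n + 3) :
    ∑ X ∈ witnessFamily K n, 1 / (((3 + X.card).choose 3 : ℕ) : ℚ) = W1.t1z0Sum n := by
  classical
  rw [sum_witnessFamily K n (fun x => 1 / (((3 + x).choose 3 : ℕ) : ℚ)), hK]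
  unfold W1.t1z0Sum
  apply Finset.sum_congr rfl
  intro i _
  rw [show 3 + (i + 1) = i + 4 by omega]
  ring

/-- The `4`-set share with `|K| = n + 3` sums to `3·t1z1Sum n`. -/
theorem sum_witness_eq_t1z1 {K : Finset α} {n : ℕ} (hK : K.card = n + 3) :
    ∑ X ∈ witnessFamily K n, 3 / (((4 + X.card).choose 3 : ℕ) : ℚ) = 3 * W1.t1z1Sum n := by
  classical
  rw [sum_witnessFamily K n (fun x => 3 / (((4 + x).choose 3 : ℕ) : ℚ)), hK]
  unfold W1.t1z1Sum
  rw [Finset.mul_sum]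
  apply Finset.sum_congr rfl
  intro i _
  rw [show 4 + (i + 1) = i + 5 by omega]
  ring

/-- `t1z0Sum n + t1z1Sum n = Φ(n + 4, 3) + 3n/(4(n + 4))` (from `C(n+4, x) = C(n+3, x) + C(n+3, x−1)`). -/
theorem t1_lp4free (n : ℕ) :
    (∑ i ∈ range n, ((n + 4).choose (i + 1) : ℚ) / ((i + 4).choose 3 : ℚ)) + 3 * (n : ℚ) / (4 * ((n : ℚ) + 4)) =
      W1.t1z0Sum n + W1.t1z1Sum n := by
  rw [CF.phi_closed, U0.phiClosed_eq_phiP, W1.t1z0_eq_P, W1.t1z1_eq_P]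
  unfold W1.t1z1P W1.t1z0P W1.t1v5P U0.phiP
  have h1 : (n : ℚ) + 4 ≠ 0 := by positivity
  have h2 : (n : ℚ) + 5 ≠ 0 := by positivity
  have h3 : (n : ℚ) + 6 ≠ 0 := by positivity
  have h4 : (n : ℚ) + 7 ≠ 0 := by positivity
  field_simp
  ring

/-- `Φ(n + 4, 3) ≤ t1z0Sum n + t1z1Sum n`. -/
theorem t1_lp4free_le (n : ℕ) :
    (∑ i ∈ range n, ((n + 4).choose (i + 1) : ℚ) / ((i + 4).choose 3 : ℚ)) ≤ W1.t1z0Sum n + W1.t1z1Sum n := by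
  have h := t1_lp4free n
  have : 0 ≤ 3 * (n : ℚ) / (4 * ((n : ℚ) + 4)) := by positivity
  linarith

/-- On a core matroid, the `3`-point line of the plane `ℓ ∪ {a}` is not inside `cl(E ∖ G)` when `ρ(E ∖ G) < ρ(M)`:
otherwise `a` would be a coloop. -/
theorem not_line_subset_closure_compl {G ℓ : Finset α} {a : α} {p : ℕ} (hc : Core M p) (hGE : G ⊆ gr M)
    (haG : a ∈ G) (hGℓ : G ⊆ insert a ℓ)
    (hlt : M.eRk ((gr M \ G : Finset α) : Set α) < M.eRank) :
    ¬ (ℓ : Set α) ⊆ M.closure ((gr M \ G : Finset α) : Set α) := by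
  intro hsub
  have hsubE : ((gr M \ G : Finset α) : Set α) ⊆ M.E := by
    rw [← coe_gr M]
    exact Finset.coe_subset.2 Finset.sdiff_subset
  have hcompl : ∀ x ∈ M.E, x ∉ G → x ∈ M.closure ((gr M \ G : Finset α) : Set α) := by
    intro x hxE hxG
    apply M.subset_closure _ hsubE
    rw [Finset.coe_sdiff, coe_gr]
    exact ⟨hxE, fun h => hxG (Finset.mem_coe.1 h)⟩
  have haF : a ∉ M.closure ((gr M \ G : Finset α) : Set α) := by
    intro haF
    have hEF : M.E ⊆ M.closure ((gr M \ G : Finset α) : Set α) := by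
      intro x hx
      by_cases hxG : x ∈ G
      · have := hGℓ hxG
        rw [Finset.mem_insert] at this
        rcases this with rfl | hxℓ
        · exact haF
        · exact hsub (Finset.mem_coe.2 hxℓ)
      · exact hcompl x hx hxG
    have hFE : M.closure ((gr M \ G : Finset α) : Set α) = M.E :=
      le_antisymm (M.closure_subset_ground _) hEF
    have : M.eRk ((gr M \ G : Finset α) : Set α) = M.eRank := by
      rw [← M.eRk_closure_eq, hFE, M.eRk_ground]
    exact absurd this hlt.ne
  have haE : a ∈ M.E := by
    rw [← coe_gr M]
    exact Finset.mem_coe.2 (hGE haG)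
  have hcol : M.IsColoop a := by
    rw [Matroid.isColoop_iff_notMem_closure_compl haE]
    intro hmem
    apply haF
    have h1 : M.E \ {a} ⊆ M.closure ((gr M \ G : Finset α) : Set α) := by
      intro x hx
      rcases hx with ⟨hxE, hxa⟩
      by_cases hxG : x ∈ G
      · have := hGℓ hxG
        rw [Finset.mem_insert] at this
        rcases this with rfl | hxℓ
        · exact absurd rfl hxa
        · exact hsub (Finset.mem_coe.2 hxℓ)
      · exact hcompl x hxE hxG
    exact M.closure_subset_closure_of_subset_closure h1 hmem
  exact hc.2.2.1 a hcol

/-- No coplanar triple when the line is outside `cl(E ∖ G)` (`K ⊆ E ∖ G` independent). -/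
theorem coplanarTriples_eq_empty_of_not_subset {ℓ K G : Finset α} (hℓE : (ℓ : Set α) ⊆ M.E)
    (hKsub : K ⊆ gr M \ G) (hKind : M.Indep (K : Set α))
    (hnot : ¬ (ℓ : Set α) ⊆ M.closure ((gr M \ G : Finset α) : Set α)) :
    coplanarTriples M ℓ K = ∅ := by
  classical
  rw [Finset.eq_empty_iff_forall_notMem]
  intro C hC
  unfold coplanarTriples at hC
  rw [Finset.mem_filter, Finset.mem_powersetCard] at hC
  obtain ⟨⟨hCK, hCc⟩, hr⟩ := hC
  apply hnot
  have hCsub : (C : Set α) ⊆ ((gr M \ G : Finset α) : Set α) := Finset.coe_subset.2 (hCK.trans hKsub)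
  have hCind : M.Indep (C : Set α) := hKind.subset (Finset.coe_subset.2 hCK)
  have hC3 : M.eRk (C : Set α) = 3 := by
    rw [hCind.eRk_eq_encard, Set.encard_coe_eq_coe_finsetCard, hCc]
    rfl
  intro x hx
  have hxE : x ∈ M.E := hℓE hx
  by_contra hxC
  have hxC' : x ∉ M.closure (C : Set α) := fun h => hxC (M.closure_mono hCsub h)
  have h1 := M.eRk_insert_eq_add_one (X := (C : Set α)) ⟨hxE, hxC'⟩
  have h2 : M.eRk (insert x (C : Set α)) ≤ M.eRk ((ℓ ∪ C : Finset α) : Set α) := by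
    apply M.eRk_mono
    intro y hy
    rw [Finset.coe_union]
    rcases hy with rfl | hyC
    · exact Or.inl hx
    · exact Or.inr hyC
  rw [h1, hC3] at h2
  have h3 : (3 : ℕ∞) + 1 ≤ 3 := h2.trans hr
  exact absurd h3 (by decide)

/-- The demand of the plane `ℓ ∪ {a}` at `t = 1` is at most `3` (the triples other than `ℓ`). -/
theorem card_UqG_three_line_point_le_t1 {G ℓ : Finset α} (hℓG : ℓ ⊆ G) (hℓr : M.eRk (ℓ : Set α) = 2)
    (hℓc : ℓ.card = 3) (hGc : G.card = 4) {n : ℕ}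
    (he : M.eRk ((gr M \ G : Finset α) : Set α) = ((n + 3 : ℕ) : ℕ∞)) : (UqG M (n + 4) 3 G).card ≤ 3 := by
  classical
  have hsub : UqG M (n + 4) 3 G ⊆ (G.powerset.filter (fun B => 3 ≤ B.card ∧ B.card + 1 ≤ G.card)).erase ℓ := by
    intro B hB
    unfold UqG at hB
    rw [Finset.mem_filter, mem_Uq] at hB
    obtain ⟨⟨_, hB3, hBp⟩, hBG⟩ := hB
    have hB3' : M.eRk (B : Set α) = 3 := by exact_mod_cast hB3
    rw [Finset.mem_erase, Finset.mem_filter, Finset.mem_powerset]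
    refine ⟨?_, hBG, three_le_card_of_eRk_eq_three hB3', ?_⟩
    · rintro rfl
      rw [hℓr] at hB3'
      exact absurd hB3' (by norm_num)
    · have h1 := eRk_sdiff_le_add M G B (gr M)
      rw [hBp, he] at h1
      have h2 : M.eRk ((G \ B : Finset α) : Set α) ≤ ((G \ B).card : ℕ∞) := by
        have := M.eRk_le_encard ((G \ B : Finset α) : Set α)
        rwa [Set.encard_coe_eq_coe_finsetCard] at this
      have h3 : ((n + 4 : ℕ) : ℕ∞) ≤ ((G \ B).card + (n + 3) : ℕ) := by
        have := h1.trans (add_le_add h2 le_rfl)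
        exact_mod_cast this
      have h4 : n + 4 ≤ (G \ B).card + (n + 3) := by exact_mod_cast h3
      have h5 := Finset.card_sdiff_add_card_eq_card hBG
      omega
  have hcard : ((G.powerset.filter (fun B => 3 ≤ B.card ∧ B.card + 1 ≤ G.card)).erase ℓ).card = 3 := by
    rw [Finset.card_erase_of_mem (by
      rw [Finset.mem_filter, Finset.mem_powerset]; exact ⟨hℓG, by omega, by omega⟩)]
    have : (G.powerset.filter (fun B => 3 ≤ B.card ∧ B.card + 1 ≤ G.card)).card = 4 := by
      have h := Finset.card_filter (fun B : Finset α => 3 ≤ B.card ∧ B.card + 1 ≤ G.card) G.powerset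
      rw [h, Finset.sum_powerset_apply_card (fun b => if 3 ≤ b ∧ b + 1 ≤ G.card then 1 else 0), hGc]
      norm_num [Finset.sum_range_succ, Nat.choose]
    rw [this]
  calc (UqG M (n + 4) 3 G).card ≤ ((G.powerset.filter (fun B => 3 ≤ B.card ∧ B.card + 1 ≤ G.card)).erase ℓ).card :=
        Finset.card_le_card hsub
    _ = 3 := hcard

open scoped Classical in
/-- **`R₃⁺` at `t = 1` on the plane `ℓ ∪ {a}`**, every `p = n + 4` (no lower bound on `n` needed), on a core matroid: with `ρ(E ∖ G) = p − 1`,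
`Φ(p, 3) · #U_G ≤ Σ_{S ∈ Yq} w⁺(G, S)` (demand `≤ 3`, no loss, supply `3(t1z0 + t1z1) ≥ 3Φ + 9n/(4(n+4))`). -/
theorem perFlat_three_line_point_t1 {G ℓ : Finset α} {n : ℕ} (hc : Core M (n + 4)) (hG : G ∈ flatsQ M 3)
    (hℓG : ℓ ⊆ G) (hℓr : M.eRk (ℓ : Set α) = 2) (hℓc : ℓ.card = 3) (hGc : G.card = 4) (hsimple : SimpleOn M G)
    (hK : M.eRk ((gr M \ G : Finset α) : Set α) = ((n + 3 : ℕ) : ℕ∞)) :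
    phiK (n + 4) 3 * ((UqG M (n + 4) 3 G).card : ℚ) ≤ ∑ S ∈ Yq M (n + 4) 3, wPlus M G S := by
  obtain ⟨K, hKsub, hKind, hKcard⟩ := exists_indep_compl_card G (le_of_eq hK.symm)
  have hKG : Disjoint K G := by
    rw [Finset.disjoint_left]
    intro x hxK hxG
    have := hKsub hxK
    rw [Finset.mem_sdiff] at this
    exact this.2 hxG
  have hGE : G ⊆ gr M := (mem_flatsQ.1 hG).1
  have hG3 : M.eRk (G : Set α) = 3 := eRk_eq_three_of_mem_flatsQ' hG
  -- the family: the three independent triples and `G`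
  set 𝒯 : Finset (Finset α) := (G.powersetCard 3).erase ℓ with h𝒯
  have hGnot : G ∉ 𝒯 := by
    rw [h𝒯, Finset.mem_erase, Finset.mem_powersetCard]
    rintro ⟨_, _, h⟩
    omega
  have h𝒯card : 𝒯.card = 3 := by
    rw [h𝒯, Finset.card_erase_of_mem (Finset.mem_powersetCard.2 ⟨hℓG, hℓc⟩), Finset.card_powersetCard, hGc]
    rfl
  have h𝒯mem : ∀ T ∈ 𝒯, T ⊆ G ∧ M.Indep (T : Set α) ∧ T.card = 3 := by
    intro T hT
    rw [h𝒯, Finset.mem_erase, Finset.mem_powersetCard] at hT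
    exact ⟨hT.2.1, indep_of_ne_line hG hℓG hℓr hℓc hGc hsimple hT.2.1 hT.2.2 hT.1, hT.2.2⟩
  set f : Finset α → Finset α → ℚ := fun B X =>
    if B = G then (if GoodWitness M ℓ K X then 3 / (((4 + X.card).choose 3 : ℕ) : ℚ) else 0)
    else 1 / (((3 + X.card).choose 3 : ℕ) : ℚ) with hf
  have hfG : ∀ X, f G X = (if GoodWitness M ℓ K X then 3 / (((4 + X.card).choose 3 : ℕ) : ℚ) else 0) := by
    intro X
    rw [hf]
    dsimp only
    rw [if_pos rfl]
  have hfT : ∀ B ∈ 𝒯, ∀ X, f B X = 1 / (((3 + X.card).choose 3 : ℕ) : ℚ) := by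
    intro B hB X
    rw [hf]
    dsimp only
    rw [if_neg (fun (h : B = G) => hGnot (h ▸ hB))]
  have hsup := supply_ge_of_family hG (𝔅 := insert G 𝒯) (fun B hB => by
      rcases Finset.mem_insert.1 hB with rfl | hB
      · exact ⟨le_rfl, hG3⟩
      · obtain ⟨hTG, hTind, hTc⟩ := h𝒯mem B hB
        exact ⟨hTG, eRk_eq_three_of_indep_card hTind hTc⟩) hKsub hKind n f (fun B hB X hX => by
      obtain ⟨hXK, _, _⟩ := mem_witnessFamily hX
      have hXind : M.Indep (X : Set α) := hKind.subset (Finset.coe_subset.2 hXK)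
      have hXG : Disjoint X G := Finset.disjoint_of_subset_left hXK hKG
      rcases Finset.mem_insert.1 hB with rfl | hB
      · rw [hfG]
        by_cases hgood : GoodWitness M ℓ K X
        · rw [if_pos hgood]
          exact wPlus_union_ge_of_good hG hℓG hℓr hℓc hGc hsimple hXind hXG hXK hgood
        · rw [if_neg hgood]
          exact wPlus_nonneg M B (B ∪ X)
      · rw [hfT B hB]
        obtain ⟨hTG, hTind, hTc⟩ := h𝒯mem B hB
        exact wPlus_union_ge_of_triple hG hsimple hTG hTind hTc hXind hXG)
  rw [Finset.sum_insert hGnot] at hsup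
  -- the point `a` off the line, and `G ⊆ insert a ℓ`
  obtain ⟨a, ha⟩ : ∃ a, G \ ℓ = {a} := by
    apply Finset.card_eq_one.1
    rw [Finset.card_sdiff_of_subset hℓG, hGc, hℓc]
  have haG : a ∈ G := by
    have : a ∈ G \ ℓ := by rw [ha]; exact Finset.mem_singleton_self a
    exact (Finset.mem_sdiff.1 this).1
  have hGℓ : G ⊆ insert a ℓ := by
    intro x hx
    rw [Finset.mem_insert]
    by_cases hxℓ : x ∈ ℓ
    · exact Or.inr hxℓ
    · left
      have : x ∈ G \ ℓ := Finset.mem_sdiff.2 ⟨hx, hxℓ⟩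
      rw [ha, Finset.mem_singleton] at this
      exact this
  -- no coplanar triple: every witness is good
  have hlt : M.eRk ((gr M \ G : Finset α) : Set α) < M.eRank := by
    rw [hK, hc.2.1]
    exact_mod_cast (by omega : n + 3 < n + 4)
  have hnot := not_line_subset_closure_compl hc hGE haG hGℓ hlt
  have hℓE : (ℓ : Set α) ⊆ M.E := by
    rw [← coe_gr M]
    exact Finset.coe_subset.2 (hℓG.trans hGE)
  have hemp := coplanarTriples_eq_empty_of_not_subset hℓE hKsub hKind hnot
  have hgoodall : ∀ X, GoodWitness M ℓ K X := by
    intro X C hC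
    rw [hemp] at hC
    exact absurd hC (Finset.notMem_empty C)
  -- the triples pay `3·t1z0`, `G` pays `3·t1z1`
  have htriples : ∑ B ∈ 𝒯, ∑ X ∈ witnessFamily K n, f B X = 3 * W1.t1z0Sum n := by
    rw [Finset.sum_congr rfl (fun B hB => Finset.sum_congr rfl (fun X _ => hfT B hB X)),
      Finset.sum_congr rfl (fun B _ => sum_witness_eq_t1z0 hKcard), Finset.sum_const, h𝒯card, nsmul_eq_mul]
    norm_num
  have hGpays : ∑ X ∈ witnessFamily K n, f G X = 3 * W1.t1z1Sum n := by
    rw [Finset.sum_congr rfl (fun X _ => by rw [hfG X, if_pos (hgoodall X)]), sum_witness_eq_t1z1 hKcard]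
  have hdem : ((UqG M (n + 4) 3 G).card : ℚ) ≤ 3 := by
    exact_mod_cast card_UqG_three_line_point_le_t1 hℓG hℓr hℓc hGc hK
  have hphi : phiK (n + 4) 3 = ∑ i ∈ range n, ((n + 4).choose (i + 1) : ℚ) / ((i + 4).choose 3 : ℚ) := by
    unfold phiK
    rw [phiW_eq_phiK_form n]
    rfl
  have hcert : phiK (n + 4) 3 ≤ W1.t1z0Sum n + W1.t1z1Sum n := by
    rw [hphi]
    exact t1_lp4free_le n
  calc phiK (n + 4) 3 * ((UqG M (n + 4) 3 G).card : ℚ)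
      ≤ phiK (n + 4) 3 * 3 := mul_le_mul_of_nonneg_left hdem (phiK_nonneg _ _)
    _ ≤ 3 * W1.t1z1Sum n + 3 * W1.t1z0Sum n := by linarith
    _ = ∑ X ∈ witnessFamily K n, f G X + ∑ B ∈ 𝒯, ∑ X ∈ witnessFamily K n, f B X := by
        rw [htriples, hGpays]
    _ ≤ ∑ S ∈ Yq M (n + 4) 3, wPlus M G S := hsup

open scoped Classical in
/-- **`R₃⁺` on the plane `ℓ ∪ {a}` at EVERY type**, every `p = n + 4 ≥ 8`, on a core matroid: `t = 0` by
`perFlat_three_line_point`, `t = 1` by `perFlat_three_line_point_t1`, `t ≥ 2` by the vanishing demand. -/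
theorem perFlat_three_line_point_all {G ℓ : Finset α} {n : ℕ} (hc : Core M (n + 4)) (hG : G ∈ flatsQ M 3)
    (hℓG : ℓ ⊆ G) (hℓr : M.eRk (ℓ : Set α) = 2) (hℓc : ℓ.card = 3) (hGc : G.card = 4) (hsimple : SimpleOn M G)
    (hn : 4 ≤ n) :
    phiK (n + 4) 3 * ((UqG M (n + 4) 3 G).card : ℚ) ≤ ∑ S ∈ Yq M (n + 4) 3, wPlus M G S := by
  obtain ⟨e, he, _⟩ := eRk_eq_nat M (gr M \ G)
  rcases le_or_gt (n + 4) e with h0 | h0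
  · exact perFlat_three_line_point hG hℓG hℓr hℓc hGc hsimple hn (by rw [he]; exact_mod_cast h0)
  rcases Nat.lt_or_ge e (n + 3) with h2 | h1
  · -- `t ≥ 2`: no demand
    have hdem := card_UqG_le_of_eRk_compl G (p := n + 4) (t := 2) he (by omega)
    have h0' : demandCount G.card 2 = 0 := by
      rw [hGc]
      unfold demandCount
      norm_num [Finset.sum_range_succ]
    rw [h0'] at hdem
    have hU : ((UqG M (n + 4) 3 G).card : ℚ) = 0 := le_antisymm hdem (by positivity)
    rw [hU, mul_zero]
    exact Finset.sum_nonneg (fun S _ => wPlus_nonneg M G S)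
  · have he' : e = n + 3 := by omega
    exact perFlat_three_line_point_t1 hc hG hℓG hℓr hℓc hGc hsimple (by rw [he, he'])

end NightThree

end PercRepro
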